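import Summits.CriticalPhenomena.PercolationContinuityZ3.Theorems.PercNearOneGluingNoHeavyLowerTailCubicThreePointBernsteinStep
import Literature.Probability.Percolation.Percolation
import Literature.Probability.LatticeModels.IsoradialPercolation
import HarnessLib
import HarnessLib.Audit.Tags

/-!
# `NoHeavyLowerTail` (stmt-CriticalPhenomena-4575) — the two Bernstein pieces of the SHK3⁺ terminal-edge step as MEASURE-LEVEL statements

Support file (`--supports stmt-CriticalPhenomena-4575`, P1 line, cell `prim-l12`).  STATEMENTS FIRST.  `CubicThreePointStep.threeB₁/threeB₂`
(harness-2) are the two Bernstein coefficients of `F = SHK3⁺` along an apex segment; `F_segment_nonneg_of_bernstein` turns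
`threeB₁ ≥ 0 ∧ threeB₂ ≥ 0` (+ `F ≥ 0` at both ends) into `F ≥ 0` on the whole segment, i.e. the terminal-edge induction step.  Here the
two inequalities are stated for the ACTUAL cells of a bond-percolation law of four marked vertices `a b c y` (`{a,y}` = the edge being
added): `q = μ(a,b,c pairwise separated)`, `u₁ = μ(ab|c)`, `u₂ = μ(ac|b)`, `u₃ = μ(bc|a)`, `t = μ(abc)`, and the transition cells
`α₁ = μ(a|by|c)`, `α₂ = μ(a|b|cy)`, `β₁ = μ(ab|cy)`, `β₂ = μ(ac|by)`, `β₃ = μ(a|bcy)` (gluing `a ~ y` moves exactly these masses: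
`Q → ab|c`, `Q → ac|b`, `ab|c → abc`, `ac|b → abc`, `bc|a → abc`).
Census (ttrl2 bern4, line 400): `B1, B2 ≥ 0` on 3 134 940 exact instances (all supports `n ≤ 7`, the `a–y` pair present and absent) + 26.5 M
composed laws, 0 violations.  OPEN; the P1 line's oracle-LP searches switching certificates for both (kit j079018 / j079015).
-/

noncomputable section

namespace Summit.CriticalPhenomena.PercolationContinuityZ3.Theorems

open MeasureTheory
open Literature.Probability.LatticeModels (prodBernoulli)
open Literature.Probability.Percolation
open CubicThreePointStep (threeB₁ threeB₂)

variable {V : Type} [Fintype V]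

/-- The ten cells of the 4-point law entering the Bernstein pieces, as events of `BondConfig V` (in the order
`q, u₁=ab|c, u₂=ac|b, u₃=bc|a, t, α₁=a|by|c, α₂=a|b|cy, β₁=ab|cy, β₂=ac|by, β₃=a|bcy`). -/
def bernsteinCells (a b c y : V) : Fin 10 → Set (BondConfig V)
  | ⟨0, _⟩ => (openConn a b)ᶜ ∩ (openConn a c)ᶜ ∩ (openConn b c)ᶜ
  | ⟨1, _⟩ => openConn a b ∩ (openConn a c)ᶜ
  | ⟨2, _⟩ => openConn a c ∩ (openConn a b)ᶜ
  | ⟨3, _⟩ => openConn b c ∩ (openConn a b)ᶜ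
  | ⟨4, _⟩ => openConn a b ∩ openConn a c
  | ⟨5, _⟩ => openConn b y ∩ (openConn a b)ᶜ ∩ (openConn a c)ᶜ ∩ (openConn b c)ᶜ
  | ⟨6, _⟩ => openConn c y ∩ (openConn a b)ᶜ ∩ (openConn a c)ᶜ ∩ (openConn b c)ᶜ
  | ⟨7, _⟩ => openConn a b ∩ openConn c y ∩ (openConn a c)ᶜ
  | ⟨8, _⟩ => openConn a c ∩ openConn b y ∩ (openConn a b)ᶜ
  | ⟨9, _⟩ => openConn b c ∩ openConn b y ∩ (openConn a b)ᶜ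

/-- **(B1) first Bernstein piece of SHK3⁺ along the apex edge `{a,y}` is nonnegative on every 4-point bond-percolation law.**
OPEN (census-validated; certificate search running). [cite: GladkovZimin2024HK, §4 (coordinate/edge induction; the inequality itself is this programme's)] [status: open] -/
@[conjecture] def BernsteinPieceB1 : Prop :=
  ∀ (V : Type) [Fintype V] (w : Sym2 V → unitInterval) (a b c y : V),
    let m : Fin 10 → ℝ := fun i => (prodBernoulli w).real (bernsteinCells a b c y i)
    0 ≤ threeB₁ (m 0) (m 1) (m 2) (m 3) (m 4) (m 5) (m 6) (m 7) (m 8) (m 9)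

/-- **(B2) second Bernstein piece of SHK3⁺ along the apex edge `{a,y}` is nonnegative on every 4-point bond-percolation law.**
OPEN (census-validated; certificate search running). [cite: GladkovZimin2024HK, §4 (coordinate/edge induction; the inequality itself is this programme's)] [status: open] -/
@[conjecture] def BernsteinPieceB2 : Prop :=
  ∀ (V : Type) [Fintype V] (w : Sym2 V → unitInterval) (a b c y : V),
    let m : Fin 10 → ℝ := fun i => (prodBernoulli w).real (bernsteinCells a b c y i)
    0 ≤ threeB₂ (m 0) (m 1) (m 2) (m 3) (m 4) (m 5) (m 6) (m 7) (m 8) (m 9)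

end Summit.CriticalPhenomena.PercolationContinuityZ3.Theorems
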